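import Summits.PneNP.PneNP.Theses.RamseyUncertifiable

/-!
# Route `RamseyUncertifiable` — the assembly `Assembly` (stmt-PneNP-9822)

Route `PneNP/RamseyUncertifiable`, item `stmt-PneNP-9822` (`Assembly`, rank 1):

  `RamseyNotNP → RamseyInCoNP → PneNP`.

If the coNP language RAMSEY₂ (adjacency codes of the graphs on `Fin n` with neither a clique nor an
independent set of size `⌈2 log₂ n⌉ = Nat.clog 2 (n²)`) is not in `NP`, then `NP ≠ coNP` and hence
Cook's `P ≠ NP` (the summit statement `PneNP`).

Proof (folklore; Cook–Reckhow 1979 §1, Arora–Barak 2009 §2.6.1), pure logic over PROVED facts of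
the tree: if `PneNP` fails then, through the model bridges
`Literature.Computability.Complexity.P_bool_eq_holds` (`PNPWave0.P Bool = Classes.P`) and
`Literature.Computability.Complexity.np_bool_eq` (`PNPWave0.NP Bool = Nondeterministic.NP`),
`Nondeterministic.NP ⊆ Classes.P`; with `P_subset_NP_holds` this is `NP = P`, so
`coNP = co NP = co P = P = NP` (`co_P_holds`), and `RamseyInCoNP` puts RAMSEY₂ in `NP`,
contradicting `RamseyNotNP`. This is the argument of the route's deciding theorem
`Summit.PneNP.PneNP.Theses.RamseyUncertifiable.closes`, whose type `Assembly` is verbatim; the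
proof below is written out against the Literature bridges directly (it does not cite `closes`).

References: S. A. Cook, R. A. Reckhow, *The relative efficiency of propositional proof systems*,
J. Symb. Logic 44 (1979), §1; S. Arora, B. Barak, *Computational Complexity: A Modern Approach*,
CUP 2009, §2.6.1 (coNP, Thm. 2.25: P = NP ⇒ NP = coNP).
-/

-- `Summit.PneNP.PneNP.…` duplicates `PneNP` BY DESIGN (single-problem summit, D-0017).
set_option linter.dupNamespace false

namespace Summit.PneNP.PneNP.Theorems

open Literature.Computability.Complexity

/-- **Assembly of route RamseyUncertifiable** (item stmt-PneNP-9822):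
`RamseyNotNP → RamseyInCoNP → PneNP`. If `PneNP` failed, the proved model bridges would give
`NP ⊆ P`, hence `NP = P` (`P_subset_NP_holds`) and `coNP = co P = P = NP` (`co_P_holds`); then
`RAMSEY₂ ∈ coNP` means `RAMSEY₂ ∈ NP`, contradicting `RamseyNotNP`.
[CookReckhow1979, §1; AroraBarak2009, §2.6.1] -/
theorem ramseyUncertifiable_assembly_proof :
    Summit.PneNP.PneNP.Theses.RamseyUncertifiable.Assembly := by
  unfold Summit.PneNP.PneNP.Theses.RamseyUncertifiable.Assembly
    Summit.PneNP.PneNP.Theses.RamseyUncertifiable.RamseyNotNP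
    Summit.PneNP.PneNP.Theses.RamseyUncertifiable.RamseyInCoNP
  intro hX hco
  by_contra h
  -- `¬ PneNP`: no language of `PNPWave0.NP Bool` lies outside `PNPWave0.P Bool`; transport
  -- through the two model bridges to the machine-based classes.
  have hsub : Nondeterministic.NP ⊆ Classes.P := by
    intro L hL
    by_contra hL'
    refine h ⟨L, ?_, ?_⟩
    · rw [np_bool_eq]
      exact hL
    · rw [P_bool_eq_holds]
      exact hL'
  -- `NP = P`, hence `coNP = co P = P = NP`.
  have heq : Nondeterministic.NP = Classes.P :=
    Set.Subset.antisymm hsub P_subset_NP_holds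
  have hcoNP : coNP = Nondeterministic.NP := by
    show co Nondeterministic.NP = Nondeterministic.NP
    rw [heq]
    exact co_P_holds
  -- RAMSEY₂ ∈ coNP = NP contradicts RAMSEY₂ ∉ NP.
  rw [hcoNP] at hco
  exact hX hco

end Summit.PneNP.PneNP.Theorems
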